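import Mathlib
import HarnessLib
import Summits.HubbardSuperconductivity.HubbardSuperconductivity.Theorems.KLProgrammeKLRegimeSplitEdgeFactsTransferLines

/-!
# Route `KLProgramme` — edge facts for the pair masses ACROSS TRANSFERS, VIII: the SOFT PHASE-SPACE COUNT `#{k : ω_k² + e_K(k⃗)² ≤ (Λ/2)²} ≲ Λ²·βL²`
# and its translates (the layer count the (D2)-deep assembly multiplies the pointwise jet rows by)

Cell gate-hubbard-kl, seat hubbard-kl-k3c1-p1 (g21; child-1 lineage).  Rows 20–22 (`…BandJets`, `…RungJets`, `…RungJetsTransport`) bound every summand of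
row 16's transfer modulus pointwise by `C·|p_Q|_𝕋²` on the transition layer of the scale-`j` symbols; what multiplies them is a COUNT of frequency–momenta in
(a translate of) the soft region.  THIS FILE derives that count from the tree's scale-LINEAR infrared phase-space sum
(`Literature.….sum_one_sub_hubbardCutoffWeightCT_div_sqrt_le_linear`, Pedra–Salmhofer 2008 Lemma 5.1: `Σ_k (1 − w^K_Λ(k))/√(ω_k² + e_K²) ≤ (7c₁ + 4c₂)·Λ·βL²`
given the level count `#{k⃗ : |e_K| < η} ≤ c₁ηL² + c₂L`): on `{ω² + e² ≤ (Λ/2)²}` the weight `w^K_Λ` vanishes (`χ₂ = 0` below `1/4`) and `1/√(ω² + e²) ≥ 2/Λ`, so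

* §1 **`klsc_card_soft_le`**: `#{k : ω_k² + e_K(k⃗)² ≤ (Λ/2)²} ≤ ((7c₁ + 4c₂)/2)·Λ²·βL²` (`0 < β ≤ L`, `π/β ≤ Λ`); on an admissible frame (`FrameOK`, level count
  `(c₁, c₂) = (1793, 704)` of `card_frameLevel_lt_le`, `Λ ≤ 3/80`) **`klsc_card_soft_le_of_frameOK`**: `≤ (15367/2)·Λ²·βL²`;
* §2 translates: `#{k : ω_k² + e_K(k⃗ + Q)² ≤ r} = #{k : ω_k² + e_K(k⃗)² ≤ r}` (`klsc_card_soft_translate`, re-indexing `k⃗ ↦ k⃗ + Q`), and the three-point region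
  the second differences at step `Q` live on: **`klsc_card_soft_three_le`** `#{k : ω² + e_K(k⃗+Q)² ≤ r ∨ ω² + e_K(k⃗)² ≤ r ∨ ω² + e_K(k⃗−Q)² ≤ r} ≤ 3·#{k : ω² + e_K(k⃗)² ≤ r}`.

Everything is proved; no definitions; nothing asserts any slot, stub, K3 or SC. [folklore]
-/

noncomputable section

namespace Summit.HubbardSuperconductivity.HubbardSuperconductivity.Theorems.KLRegimeSplit

set_option linter.dupNamespace false -- summit = problem name (single-conjunct summit), D-0017

open Real Finset Literature.MathematicalPhysics.QuantumLattice Literature.Probability.LatticeModels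
open Literature.MathematicalPhysics.QuantumLattice.FermiRG
open Summit.HubbardSuperconductivity.HubbardSuperconductivity.Theorems.KLProgrammeLegKernels
open Summit.HubbardSuperconductivity.HubbardSuperconductivity.Theorems.TwoPointAssembly

section Count

variable {L M : ℕ} [NeZero L] {β : ℝ} (μ : ℝ) (K : TrigPolyC4v)

/-! ## §1 The soft count from the scale-linear phase-space sum -/

/-- **Soft phase-space count**: `0 < β ≤ L`, `0 < Λ`, `π/β ≤ Λ`, level count `#{k⃗ : |e_K(k⃗)| < η} ≤ c₁ηL² + c₂L` for `0 < η ≤ Λ` ⟹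
`#{k : ω_k² + e_K(k⃗)² ≤ (Λ/2)²} ≤ ((7c₁ + 4c₂)/2)·Λ²·βL²`. [cite: PedraSalmhofer2008, Lemma 5.1] -/
theorem klsc_card_soft_le (hβ : 0 < β) {Λ c₁ c₂ : ℝ} (hΛ : 0 < Λ) (hΛβ : Real.pi / β ≤ Λ) (hβL : β ≤ L) (hc₁ : 0 ≤ c₁) (hc₂ : 0 ≤ c₂)
    (hcount : ∀ η : ℝ, 0 < η → η ≤ Λ →
      (((univ : Finset (TorusSite 2 L)).filter fun k => |nambuXiCT L μ K k| < η).card : ℝ) ≤ c₁ * η * (L : ℝ) ^ 2 + c₂ * L) :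
    (((univ : Finset (FreqMomentum L M)).filter fun k => matsubaraFreq β M k.1 ^ 2 + nambuXiCT L μ K k.2 ^ 2 ≤ (Λ / 2) ^ 2).card : ℝ) ≤
      (7 * c₁ + 4 * c₂) / 2 * Λ ^ 2 * (β * (L : ℝ) ^ 2) := by
  have hsum := sum_one_sub_hubbardCutoffWeightCT_div_sqrt_le_linear (M := M) hβ μ K hΛ hΛβ hβL hc₁ hc₂ hcount
  set S := (univ : Finset (FreqMomentum L M)).filter fun k => matsubaraFreq β M k.1 ^ 2 + nambuXiCT L μ K k.2 ^ 2 ≤ (Λ / 2) ^ 2 with hS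
  set f : FreqMomentum L M → ℝ := fun k => (1 - hubbardCutoffWeightCT L M β μ K Λ k) /
    Real.sqrt (matsubaraFreq β M k.1 ^ 2 + nambuXiCT L μ K k.2 ^ 2) with hf
  have hf0 : ∀ k, 0 ≤ f k := fun k => by
    have h1 := (salmhoferCutoff_mem_Icc ((matsubaraFreq β M k.1 ^ 2 + nambuXiCT L μ K k.2 ^ 2) / Λ ^ 2)).2
    simp only [hf, hubbardCutoffWeightCT]
    exact div_nonneg (by linarith) (Real.sqrt_nonneg _)
  have hfS : ∀ k ∈ S, 2 / Λ ≤ f k := by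
    intro k hk
    rw [hS, mem_filter] at hk
    obtain ⟨-, hk⟩ := hk
    set r2 := matsubaraFreq β M k.1 ^ 2 + nambuXiCT L μ K k.2 ^ 2 with hr2
    have hω : 0 < matsubaraFreq β M k.1 ^ 2 := by
      have := matsubaraFreq_ne_zero hβ.ne' k.1
      positivity
    have hr0 : 0 < r2 := by have := sq_nonneg (nambuXiCT L μ K k.2); simp only [hr2]; linarith
    have hw0 : hubbardCutoffWeightCT L M β μ K Λ k = 0 := by
      refine salmhoferCutoff_of_le ?_
      rw [div_le_iff₀ (by positivity)]
      nlinarith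
    have hsq : Real.sqrt r2 ≤ Λ / 2 := by
      rw [← Real.sqrt_sq (by positivity : (0 : ℝ) ≤ Λ / 2)]
      exact Real.sqrt_le_sqrt hk
    have hsq0 : 0 < Real.sqrt r2 := Real.sqrt_pos.2 hr0
    simp only [hf, hw0, sub_zero]
    rw [show (2 : ℝ) / Λ = 1 / (Λ / 2) by field_simp]
    exact one_div_le_one_div_of_le hsq0 hsq
  have h1 : (S.card : ℝ) * (2 / Λ) ≤ ∑ k ∈ S, f k := by
    have := Finset.card_nsmul_le_sum S f (2 / Λ) hfS
    rwa [nsmul_eq_mul] at this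
  have h2 : ∑ k ∈ S, f k ≤ ∑ k, f k := Finset.sum_le_univ_sum_of_nonneg hf0
  have h3 : (S.card : ℝ) * (2 / Λ) ≤ (7 * c₁ + 4 * c₂) * Λ * β * (L : ℝ) ^ 2 := h1.trans (h2.trans hsum)
  rw [mul_div_assoc', div_le_iff₀ hΛ] at h3
  have hid : (7 * c₁ + 4 * c₂) / 2 * Λ ^ 2 * (β * (L : ℝ) ^ 2) = (7 * c₁ + 4 * c₂) * Λ * β * (L : ℝ) ^ 2 * Λ / 2 := by ring
  rw [hid]
  linarith

/-- **Soft phase-space count on an admissible frame**: `FrameOK R U N μ K`, `0 < β ≤ L`, `π/β ≤ Λ ≤ 3/80` ⟹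
`#{k : ω_k² + e_K(k⃗)² ≤ (Λ/2)²} ≤ (15367/2)·Λ²·βL²` (`7·1793 + 4·704 = 15367`). [folklore] -/
theorem klsc_card_soft_le_of_frameOK {R : RenConsts} {U : ℝ} {N : ℕ} (hK : FrameOK R U N μ K) (hβ : 0 < β) {Λ : ℝ} (hΛ : 0 < Λ)
    (hΛβ : Real.pi / β ≤ Λ) (hΛr : Λ ≤ 3 / 80) (hβL : β ≤ L) :
    (((univ : Finset (FreqMomentum L M)).filter fun k => matsubaraFreq β M k.1 ^ 2 + nambuXiCT L μ K k.2 ^ 2 ≤ (Λ / 2) ^ 2).card : ℝ) ≤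
      15367 / 2 * Λ ^ 2 * (β * (L : ℝ) ^ 2) := by
  have h := klsc_card_soft_le (M := M) μ K hβ hΛ hΛβ hβL (by norm_num : (0 : ℝ) ≤ 1793) (by norm_num : (0 : ℝ) ≤ 704)
    (fun η hη hηΛ => card_frameLevel_lt_le hK hη (hηΛ.trans hΛr))
  norm_num at h
  linarith

/-! ## §2 Translates and the three-point region -/

/-- **Translating the momentum does not change the count**: `#{k : ω_k² + e_K(k⃗ + Q)² ≤ r} = #{k : ω_k² + e_K(k⃗)² ≤ r}`. [folklore] -/
theorem klsc_card_soft_translate (β : ℝ) (Q : TorusSite 2 L) (r : ℝ) :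
    ((univ : Finset (FreqMomentum L M)).filter fun k => matsubaraFreq β M k.1 ^ 2 + nambuXiCT L μ K (k.2 + Q) ^ 2 ≤ r).card =
      ((univ : Finset (FreqMomentum L M)).filter fun k => matsubaraFreq β M k.1 ^ 2 + nambuXiCT L μ K k.2 ^ 2 ≤ r).card := by
  refine Finset.card_equiv ((Equiv.refl (MatsubaraIdx M)).prodCongr (Equiv.addRight Q)) fun k => ?_
  obtain ⟨ν, p⟩ := k
  simp

/-- **The three-point region**: `#{k : ω² + e_K(k⃗+Q)² ≤ r ∨ ω² + e_K(k⃗)² ≤ r ∨ ω² + e_K(k⃗−Q)² ≤ r} ≤ 3·#{k : ω² + e_K(k⃗)² ≤ r}` — the set off which the second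
differences at step `Q` of anything supported in `{ω² + e_K² ≤ r}` vanish. [folklore] -/
theorem klsc_card_soft_three_le (β : ℝ) (Q : TorusSite 2 L) (r : ℝ) :
    ((univ : Finset (FreqMomentum L M)).filter fun k =>
        matsubaraFreq β M k.1 ^ 2 + nambuXiCT L μ K (k.2 + Q) ^ 2 ≤ r ∨ (matsubaraFreq β M k.1 ^ 2 + nambuXiCT L μ K k.2 ^ 2 ≤ r ∨
          matsubaraFreq β M k.1 ^ 2 + nambuXiCT L μ K (k.2 - Q) ^ 2 ≤ r)).card ≤
      3 * ((univ : Finset (FreqMomentum L M)).filter fun k => matsubaraFreq β M k.1 ^ 2 + nambuXiCT L μ K k.2 ^ 2 ≤ r).card := by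
  have hp := klsc_card_soft_translate (M := M) μ K β Q r
  have hm := klsc_card_soft_translate (M := M) μ K β (-Q) r
  simp only [← sub_eq_add_neg] at hm
  rw [filter_or, filter_or]
  refine (card_union_le _ _).trans ((Nat.add_le_add_left (card_union_le _ _) _).trans ?_)
  rw [hp, hm]
  omega

end Count

end Summit.HubbardSuperconductivity.HubbardSuperconductivity.Theorems.KLRegimeSplit

end
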